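import Literature.Geometry.Kaehler.ComplexTorusLefschetzHodgeInvolutions
import Literature.Geometry.Kaehler.ComplexTorusLefschetzInvolutionsPoincareSelfAdjoint
import Literature.Geometry.Kaehler.ComplexTorusWeylOperatorHodgeClasses
import Literature.Geometry.Kaehler.GradedFormsWeightOperatorsHodge
import HarnessLib

/-!
# `*_L` and Kleiman–Milne's `∗` are DEFINED OVER `ℚ` on a polarised complex torus, have bidegree-reflecting Hodge type, and
# permute the Hodge classes: `*_L, ∗ : Hdgᵖ(X) ⥲ Hdg^{g-p}(X)` (Milne 1999, Thm. 5.9: "`∗` […] Lefschetz"; Kleiman 1968, 1.4.4: `∗ ∈ ℚ[L, Λ]`)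

Layer `Literature/Geometry/Kaehler`, namespace `Literature.Geometry.Kaehler.ComplexTorus`; lane `lit-hodgefound` (Track 2 foundations library),
prover seat `lit-hodgefound-p35` (generation 50, row g50-#6; sequel of rows g50-#4 `ComplexTorusLefschetzHodgeInvolutions` and g50-#5
`ComplexTorusLefschetzInvolutionsPoincareSelfAdjoint`). THEOREMS ONLY (no definition, no named fact, no instance, no notation; D-0026 net debt `0`).
Consumed BY NAME, nothing restated: row g50-#4 (the string formulas `lefschetzInvolution_of_lefschetzPow_of_mem_primitiveForms`,
`hodgeInvolution_of_lefschetzPow_of_mem_primitiveForms`), row g50-#5 (homogeneity `lefschetzInvolution_of_eq_of`, `hodgeInvolution_of_eq_of`), p09's Weyl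
operator (`weylOperator_of_lefschetzPow_of_mem_primitiveForms`), p35's g47-#3 `ComplexTorusWeylOperatorRationalLefschetzSummands` (**`w` is defined over `ℚ`**:
`IsNSForm.weylOperator_of_apply_mem_rationalForms`), g47-#5 `weylOperator_of_apply_mem_typeSubmodule`, p09's Milne projectors `primitiveProj η m r = ℓ_r(ᶜΛ L)`
(`ComplexTorusKleimanLefschetzOperators`: `sum_primitiveProj_apply`, `primitiveProj_apply_mem`, `primitiveProj_apply_mem_rationalForms`; g21-#2
`primitiveProj_apply_mem_typeSubmodule`) and the rational structure `rationalForms Φ k = Hᵏ(X, ℚ)`, `rationalFormsG`, `rationalEnd Φ = 𝔤𝔩(H•(X; ℚ))`,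
`hodgeClassesIn Φ k p = Hᵏ(X, ℚ) ∩ H^{p,p}`, `hodgeClasses Φ p = Hdgᵖ(X)`.

METHOD (Milne's proof of Thm. 5.9, p. 665: "all elements of the `ℚ`-algebra `ℚ[L, Λ]` are Lefschetz. Since this algebra contains `ᶜΛ` and `∗`"). On each
Lefschetz summand `Lʲ Pᵏ ⊂ Hᵃ` the three operators `w`, `*_L`, `∗` are proportional with RATIONAL factors (§1: `*_L = (-1)^{n+j} (r!/j!) w`,
`∗ = (-1)^{n+j} (-1)^{k(k+1)/2} (r!/j!) w`, `k + n = g`, `j + r = n`); a rational class `x ∈ Hᵃ(X, ℚ)` splits as `x = Σ_r π_{a,r} x` into RATIONAL summand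
components (the projectors are Lagrange polynomials in `ᶜΛ L`, which is rational for `η ∈ NS(X)`), and `w` is rational (`w = ρ(0 -1 ; 1 0)`, `ρ(SL₂(ℤ)) ⊆ GL(H•(X; ℚ))`).
The same splitting with the bidegree-`(0,0)` projectors transfers Huybrechts' type rule for `w` (Lemma 1.2.24 (ii)) to `*_L` and `∗`.

## Sources, VERBATIM

* J. S. Milne, *Lefschetz classes on abelian varieties*, Duke Math. J. 96 (1999) [Milne1999LefschetzClasses], held `paper:doi-10-1215-s0012-7094-99-09620-5`,
  §5 p. 664 (p0026 L55–L70): "`∗x = Σ_{i ≥ s-d, 0} (-1)^{(s-2i)(s-2i+1)/2} L^{d-s+i} xᵢ`. **Theorem 5.9.** Let `A` be an abelian variety […] The correspondences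
  `Λ`, `ᶜΛ`, and `∗` between `A` and itself are all Lefschetz."; p. 665 (p0027 L5–L9): "all elements of the `ℚ`-algebra `ℚ[L, Λ]` are Lefschetz. Since this
  algebra contains `ᶜΛ` and `∗` (Kleiman 1968, 1.4.4), this proves the theorem"; Rem. 5.11.
* Y. André, *Pour une théorie inconditionnelle des motifs*, Publ. Math. IHÉS 83 (1996) [Andre1996Motifs], held `paper:doi-10-1007-bf02698643`, §1.1 (p. 10):
  "`*_L x = Σ L^{d-j+k} x_{j-2k}`"; Prop. 1.2 (p. 11): "Les sous-algèbres `ℚ[L, *_L]`, `ℚ[L, *_H]`, `ℚ[L, *_L L *_L]`, `ℚ[L, ᶜΛ]` de `End H*(X)` sont égales".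
* E. Looijenga, V. A. Lunts, *A Lie algebra attached to a projective variety*, Invent. Math. 129 (1997) [LooijengaLunts1997], §1 (1.7): "if `M` […] and the
  action of `𝔞` on `M` are defined over a subfield […] `𝔤(𝔞, M)` is […] also defined over" it.
* D. Huybrechts, *Complex Geometry* (2005) [Huybrechts2005], §1.2 Lemma 1.2.24 (ii) (p0047 L2), Rem. 1.2.33; Prop. 3.3.13 (Lefschetz decomposition compatible
  with the bidegree). C. Voisin, *Hodge Theory I* (2002) [VoisinHodgeI2002], §7.1.2 (PDF p. 134): the Lefschetz decomposition "of rational sub-Hodge structures".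
* H. Lange, *Abelian Varieties over the Complex Numbers* (2023) [Lange2023AbelianVarietiesComplex], §7.2.2 (Hodge classes), §7.3.3 Exercise (1).

## What is proved

* §1 (any non-degenerate `η`, `dim_ℂ X = g`) **`lefschetzInvolution_of_eq_smul_weylOperator_of_of_mem_lefschetzSummandForms`** (`*_L = (-1)^{n+j} (r!/j!) · w` on
  `Lʲ Pᵏ ⊂ Hᵃ`, `k + n = g`, `j + r = n`) and **`hodgeInvolution_of_eq_smul_weylOperator_of_of_mem_lefschetzSummandForms`** (`∗ = (-1)^{n+j} (-1)^{k(k+1)/2} (r!/j!) · w`).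
* §2 `η ∈ NS(X)` NON-DEGENERATE (every polarised torus): **`IsNSForm.lefschetzInvolution_of_apply_mem_rationalForms`** (`*_L(Hᵃ(X, ℚ)) ⊆ Hᵇ(X, ℚ)` componentwise),
  `IsNSForm.lefschetzInvolution_apply_mem_rationalFormsG`, **`IsNSForm.lefschetzInvolution_mem_rationalEnd`** (**`*_L ∈ 𝔤𝔩(H•(X; ℚ))`: THE LEFSCHETZ INVOLUTION IS
  DEFINED OVER `ℚ`**); **`IsNSForm.hodgeInvolution_of_apply_mem_rationalForms`**, `IsNSForm.hodgeInvolution_apply_mem_rationalFormsG`,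
  **`IsNSForm.hodgeInvolution_mem_rationalEnd`** (**KLEIMAN–MILNE'S `∗` IS DEFINED OVER `ℚ`** — the content of "this algebra contains `∗`" for the rational structure).
* §3 (`η` of type `(1,1)`, non-degenerate) `lefschetzInvolution_of_apply_mem_typeSubmodule`, `hodgeInvolution_of_apply_mem_typeSubmodule` (`*_L, ∗ : H^{p,q} ∩ Hᵃ →
  H^{g-q,g-p} ∩ Hᵇ`); for `η ∈ NS(X)`: **`IsNSForm.lefschetzInvolution_of_apply_mem_hodgeClassesIn`**, `IsNSForm.image_/bijOn_lefschetzInvolution_of_hodgeClassesIn`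
  (**`*_L : Hᵃ(X, ℚ) ∩ H^{p,p} ⥲ Hᵇ(X, ℚ) ∩ H^{g-p,g-p}`**, `a + b = 2g`), **`IsNSForm.bijOn_lefschetzInvolution_of_hodgeClasses`** (`*_L : Hdgᵖ(X) ⥲ Hdg^{g-p}(X)`), and the
  same four for `∗` (**`IsNSForm.bijOn_hodgeInvolution_of_hodgeClasses`**: Kleiman–Milne's `∗` permutes the Hodge classes of complementary codimension — on an
  abelian variety it is even a Lefschetz correspondence, Milne's Thm. 5.9, which is not formalised here).

## Scope / not here

Milne's algebraicity of `∗` (Thm. 5.9 proper) and André's equality of algebras `ℚ[L, *_L] = ℚ[L, Λ]` (Prop. 1.2) are not re-proved; only invariant forms of complex tori.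
-/

noncomputable section

-- `Module ℂ` / `SMulZeroClass ℂ` synthesis on `E [⋀^Fin k]→L[ℝ] ℂ` (as in `ComplexTorusLefschetzDecomposition`)
set_option maxSynthPendingDepth 3

namespace Literature.Geometry.Kaehler

namespace ComplexTorus

open Module Function Finset
open Literature.LinearAlgebra.Alternating Literature.Algebra.Lie Literature.Analysis.Complex

universe uE

/-! ## §1 On a Lefschetz summand `*_L` and `∗` are rational multiples of the Weyl operator -/

section Summand

variable {E : Type uE} [NormedAddCommGroup E] [NormedSpace ℂ E] [FiniteDimensional ℂ E] [Nontrivial E] {η : E [⋀^Fin 2]→L[ℝ] ℝ}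
  (hη : ∀ v : E, v ≠ 0 → ∃ w : E, η ![v, w] ≠ 0)

omit [FiniteDimensional ℂ E] [Nontrivial E] in
/-- `((-1)ᵏ)² = 1` in `ℂ`. [folklore] -/
private theorem neg_one_pow_mul_self₅₆ (k : ℕ) : ((-1 : ℂ) ^ k) * (-1) ^ k = 1 := by
  rw [← pow_add, ← two_mul, pow_mul, neg_one_sq, one_pow]

omit [FiniteDimensional ℂ E] [Nontrivial E] in
/-- `((-1)^{n+j} r!/j!) · ((-1)^{n+j} j!/r!) = 1`. [folklore] -/
private theorem factor_mul_weylFactor₅₆ (n j r : ℕ) :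
    ((-1 : ℂ) ^ (n + j) * ((r.factorial : ℕ) : ℂ) * (((j.factorial : ℕ) : ℂ))⁻¹) *
      ((-1 : ℂ) ^ (n + j) * ((j.factorial : ℕ) : ℂ) * (((r.factorial : ℕ) : ℂ))⁻¹) = 1 := by
  have hr : ((r.factorial : ℕ) : ℂ) ≠ 0 := Nat.cast_ne_zero.2 (Nat.factorial_ne_zero r)
  have hj : ((j.factorial : ℕ) : ℂ) ≠ 0 := Nat.cast_ne_zero.2 (Nat.factorial_ne_zero j)
  rw [show ((-1 : ℂ) ^ (n + j) * ((r.factorial : ℕ) : ℂ) * (((j.factorial : ℕ) : ℂ))⁻¹) *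
      ((-1 : ℂ) ^ (n + j) * ((j.factorial : ℕ) : ℂ) * (((r.factorial : ℕ) : ℂ))⁻¹) =
      ((-1 : ℂ) ^ (n + j) * (-1) ^ (n + j)) * ((((r.factorial : ℕ) : ℂ)) * (((r.factorial : ℕ) : ℂ))⁻¹) *
        ((((j.factorial : ℕ) : ℂ))⁻¹ * ((j.factorial : ℕ) : ℂ)) by ring,
    neg_one_pow_mul_self₅₆, mul_inv_cancel₀ hr, inv_mul_cancel₀ hj, one_mul, one_mul]

include hη

/-- **`*_L = (-1)^{n+j} (r!/j!) · w` on the Lefschetz summand `Lʲ Pᵏ ⊂ Hᵃ(X; ℂ)`** (`k + n = g = dim_ℂ X`, `j + r = n`, `a = k + 2j`): André's `*_L(Lʲχ) = Lʳχ` (row g50-#4)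
against the Weyl element `w(Lʲχ) = (-1)^{n+j} (j!/r!) Lʳχ` (p09) — a RATIONAL factor on each summand ("`ℚ[L, *_L] = ℚ[L, Λ]`").
[cite: Andre1996Motifs, §1.1 (p. 10), Prop. 1.2 (p. 11)] [cite: Milne1999LefschetzClasses, §5 p. 665 (proof of Thm. 5.9)] -/
theorem lefschetzInvolution_of_eq_smul_weylOperator_of_of_mem_lefschetzSummandForms {g : ℕ} (hg : finrank ℂ E = g) {k n j r a : ℕ}
    (hkn : k + n = g) (hjr : j + r = n) (ha : 2 * j + k = a) {x : E [⋀^Fin a]→L[ℝ] ℂ} (hx : x ∈ lefschetzSummandForms η a j) :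
    (hasLefschetzProperty_lefschetzG hη).lefschetzInvolution isZGrading_countingG (GForm.of a x) =
      ((-1 : ℂ) ^ (n + j) * ((r.factorial : ℕ) : ℂ) * (((j.factorial : ℕ) : ℂ))⁻¹) •
        (hasLefschetzProperty_lefschetzG hη).weylOperator isZGrading_countingG (GForm.of a x) := by
  rw [lefschetzSummandForms_eq η ha] at hx
  obtain ⟨χ, hχ, rfl⟩ := hx
  rw [weylOperator_of_lefschetzPow_of_mem_primitiveForms hη (by omega) hχ hjr ha (show 2 * r + k = 2 * r + k from rfl),
    lefschetzInvolution_of_lefschetzPow_of_mem_primitiveForms hη hg hkn hχ hjr ha rfl, smul_smul, factor_mul_weylFactor₅₆, one_smul]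

/-- **`∗ = (-1)^{n+j} (-1)^{k(k+1)/2} (r!/j!) · w` on `Lʲ Pᵏ ⊂ Hᵃ(X; ℂ)`** (`k + n = g`, `j + r = n`): Kleiman–Milne's `∗(Lʲχ) = (-1)^{k(k+1)/2} Lʳχ` against `w` —
"this algebra contains […] `∗` (Kleiman 1968, 1.4.4)". [cite: Milne1999LefschetzClasses, §5 pp. 664–665 (p0026 L55–L70, p0027 L5–L9)] [cite: Kleiman1968AlgebraicCycles, §1.4, 1.4.4] -/
theorem hodgeInvolution_of_eq_smul_weylOperator_of_of_mem_lefschetzSummandForms {g : ℕ} (hg : finrank ℂ E = g) {k n j r a : ℕ}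
    (hkn : k + n = g) (hjr : j + r = n) (ha : 2 * j + k = a) {x : E [⋀^Fin a]→L[ℝ] ℂ} (hx : x ∈ lefschetzSummandForms η a j) :
    (hasLefschetzProperty_lefschetzG hη).hodgeInvolution isZGrading_countingG g (GForm.of a x) =
      ((-1 : ℂ) ^ (n + j) * (-1 : ℂ) ^ (k * (k + 1) / 2) * ((r.factorial : ℕ) : ℂ) * (((j.factorial : ℕ) : ℂ))⁻¹) •
        (hasLefschetzProperty_lefschetzG hη).weylOperator isZGrading_countingG (GForm.of a x) := by
  rw [lefschetzSummandForms_eq η ha] at hx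
  obtain ⟨χ, hχ, rfl⟩ := hx
  rw [weylOperator_of_lefschetzPow_of_mem_primitiveForms hη (by omega) hχ hjr ha (show 2 * r + k = 2 * r + k from rfl),
    hodgeInvolution_of_lefschetzPow_of_mem_primitiveForms hη hg hkn hχ hjr ha rfl, smul_smul,
    show (-1 : ℂ) ^ (n + j) * (-1 : ℂ) ^ (k * (k + 1) / 2) * ((r.factorial : ℕ) : ℂ) * (((j.factorial : ℕ) : ℂ))⁻¹ *
        ((-1 : ℂ) ^ (n + j) * ((j.factorial : ℕ) : ℂ) * (((r.factorial : ℕ) : ℂ))⁻¹) =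
      (-1 : ℂ) ^ (k * (k + 1) / 2) * (((-1 : ℂ) ^ (n + j) * ((r.factorial : ℕ) : ℂ) * (((j.factorial : ℕ) : ℂ))⁻¹) *
        ((-1 : ℂ) ^ (n + j) * ((j.factorial : ℕ) : ℂ) * (((r.factorial : ℕ) : ℂ))⁻¹)) by ring,
    factor_mul_weylFactor₅₆, mul_one]

end Summand

/-! ## §2 `*_L` and `∗` are defined over `ℚ` -/

section Rational

variable {ι : Type*} [Fintype ι] [DecidableEq ι] {E : Type uE} [NormedAddCommGroup E] [NormedSpace ℂ E] [FiniteDimensional ℂ E] [Nontrivial E]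
  (Φ : (ι → ℝ) ≃L[ℝ] E) {η : E [⋀^Fin 2]→L[ℝ] ℝ}

omit [Fintype ι] [DecidableEq ι] [FiniteDimensional ℂ E] [Nontrivial E] in
/-- A rational multiple of a member of a `ℚ`-subspace of forms is a member. [folklore] -/
private theorem ratCast_smul_mem₅₆ {k : ℕ} {S : Submodule ℚ (E [⋀^Fin k]→L[ℝ] ℂ)} {T : E [⋀^Fin k]→L[ℝ] ℂ} (hT : T ∈ S) (q : ℚ) :
    ((q : ℂ)) • T ∈ S := by
  rw [Rat.cast_smul_eq_qsmul]
  exact S.smul_mem q hT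

omit [Fintype ι] [DecidableEq ι] [FiniteDimensional ℂ E] [Nontrivial E] in
/-- The factor `(-1)^{m} r!/j!` is a rational number. [folklore] -/
private theorem factor_eq_ratCast₅₆ (m r j : ℕ) :
    (-1 : ℂ) ^ m * ((r.factorial : ℕ) : ℂ) * (((j.factorial : ℕ) : ℂ))⁻¹ =
      (((-1 : ℚ) ^ m * ((r.factorial : ℕ) : ℚ) * (((j.factorial : ℕ) : ℚ))⁻¹ : ℚ) : ℂ) := by
  push_cast; rfl

omit [Fintype ι] [DecidableEq ι] [FiniteDimensional ℂ E] [Nontrivial E] in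
/-- The factor `(-1)^{m} (-1)^{c} r!/j!` is a rational number. [folklore] -/
private theorem factor_eq_ratCast₅₆' (m c r j : ℕ) :
    (-1 : ℂ) ^ m * (-1 : ℂ) ^ c * ((r.factorial : ℕ) : ℂ) * (((j.factorial : ℕ) : ℂ))⁻¹ =
      (((-1 : ℚ) ^ m * (-1 : ℚ) ^ c * ((r.factorial : ℕ) : ℚ) * (((j.factorial : ℕ) : ℚ))⁻¹ : ℚ) : ℂ) := by
  push_cast; rfl

omit [Fintype ι] [DecidableEq ι] [Nontrivial E] in
/-- Forms of degree above `2g = dim_ℝ E` vanish. [folklore] -/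
private theorem eq_zero_of_two_mul_finrank_lt₅₆ {a : ℕ} (ha : 2 * finrank ℂ E < a) (x : E [⋀^Fin a]→L[ℝ] ℂ) : x = 0 :=
  eq_zero_of_finrank_real_lt x (by rw [finrank_real_of_complex]; omega)

/-- **`*_L(Hᵃ(X, ℚ)) ⊆ Hᵇ(X, ℚ)` componentwise, for every non-degenerate `η ∈ NS(X)`**: a rational class splits into its rational Lefschetz components
`x = Σ_r π_{a,r} x` (Milne's projectors are polynomials in the rational `ᶜΛ L`), on each of which `*_L` is a rational multiple of the rational Weyl operator.
[cite: Milne1999LefschetzClasses, §5 p. 665 (proof of Thm. 5.9)] [cite: Andre1996Motifs, Prop. 1.2 (p. 11)] [cite: LooijengaLunts1997, §1 (1.7)] -/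
theorem IsNSForm.lefschetzInvolution_of_apply_mem_rationalForms (hNS : IsNSForm Φ η) (hη : ∀ v : E, v ≠ 0 → ∃ w : E, η ![v, w] ≠ 0) {a : ℕ}
    {x : E [⋀^Fin a]→L[ℝ] ℂ} (hx : x ∈ rationalForms Φ a) (b : ℕ) :
    (hasLefschetzProperty_lefschetzG hη).lefschetzInvolution isZGrading_countingG (GForm.of a x) b ∈ rationalForms Φ b := by
  rcases Nat.lt_or_ge (2 * finrank ℂ E) a with ha | ha
  · rw [eq_zero_of_two_mul_finrank_lt₅₆ ha x, GForm.of_zero, map_zero, Pi.zero_apply]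
    exact zero_mem _
  · rw [← sum_primitiveProj_apply (η := η) ha x, GForm.of_sum, map_sum, Finset.sum_apply]
    refine Submodule.sum_mem _ fun r hr ↦ ?_
    obtain ⟨har, h2r⟩ := mem_lefschetzRange.1 hr
    rw [lefschetzInvolution_of_eq_smul_weylOperator_of_of_mem_lefschetzSummandForms hη rfl (k := a - 2 * r) (n := finrank ℂ E + 2 * r - a)
      (r := finrank ℂ E + r - a) (by omega) (by omega) (by omega) (primitiveProj_apply_mem hη ha r x), Pi.smul_apply, factor_eq_ratCast₅₆]
    exact ratCast_smul_mem₅₆ (hNS.weylOperator_of_apply_mem_rationalForms Φ hη (primitiveProj_apply_mem_rationalForms Φ hNS hη r hx) b) _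

/-- **`*_L(H•(X; ℚ)) ⊆ H•(X; ℚ)`.** [cite: Milne1999LefschetzClasses, §5 p. 665 (proof of Thm. 5.9)] [cite: LooijengaLunts1997, §1 (1.7)] -/
theorem IsNSForm.lefschetzInvolution_apply_mem_rationalFormsG (hNS : IsNSForm Φ η) (hη : ∀ v : E, v ≠ 0 → ∃ w : E, η ![v, w] ≠ 0) {w : GForm E ℂ}
    (hw : w ∈ rationalFormsG Φ) : (hasLefschetzProperty_lefschetzG hη).lefschetzInvolution isZGrading_countingG w ∈ rationalFormsG Φ := by
  rw [← sum_range_of_eq w, map_sum]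
  refine Submodule.sum_mem _ fun m _ ↦ (mem_rationalFormsG_iff Φ).2 fun b ↦ ?_
  exact hNS.lefschetzInvolution_of_apply_mem_rationalForms Φ hη ((mem_rationalFormsG_iff Φ).1 hw m) b

/-- **THE LEFSCHETZ INVOLUTION IS DEFINED OVER `ℚ`: `*_L ∈ 𝔤𝔩(H•(X; ℚ))`** (`rationalEnd Φ`) for every non-degenerate `η ∈ NS(X)` — André's `*_L ∈ ℚ[L, Λ] ⊂ End H•(X, ℚ)`.
[cite: Andre1996Motifs, §1.1 (p. 10), Prop. 1.2 (p. 11)] [cite: Milne1999LefschetzClasses, §5 p. 665 (proof of Thm. 5.9)] [cite: LooijengaLunts1997, §1 (1.7)] -/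
theorem IsNSForm.lefschetzInvolution_mem_rationalEnd (hNS : IsNSForm Φ η) (hη : ∀ v : E, v ≠ 0 → ∃ w : E, η ![v, w] ≠ 0) :
    (hasLefschetzProperty_lefschetzG hη).lefschetzInvolution isZGrading_countingG ∈ rationalEnd Φ :=
  fun _ hw ↦ hNS.lefschetzInvolution_apply_mem_rationalFormsG Φ hη hw

/-- **`∗(Hᵃ(X, ℚ)) ⊆ Hᵇ(X, ℚ)` componentwise** (Kleiman–Milne's `∗`, normalised by `d = g`), for every non-degenerate `η ∈ NS(X)`.
[cite: Milne1999LefschetzClasses, §5 pp. 664–665 (proof of Thm. 5.9: "this algebra contains `ᶜΛ` and `∗`")] [cite: Kleiman1968AlgebraicCycles, §1.4, 1.4.4] -/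
theorem IsNSForm.hodgeInvolution_of_apply_mem_rationalForms (hNS : IsNSForm Φ η) (hη : ∀ v : E, v ≠ 0 → ∃ w : E, η ![v, w] ≠ 0) {a : ℕ}
    {x : E [⋀^Fin a]→L[ℝ] ℂ} (hx : x ∈ rationalForms Φ a) (b : ℕ) :
    (hasLefschetzProperty_lefschetzG hη).hodgeInvolution isZGrading_countingG (finrank ℂ E) (GForm.of a x) b ∈ rationalForms Φ b := by
  rcases Nat.lt_or_ge (2 * finrank ℂ E) a with ha | ha
  · rw [eq_zero_of_two_mul_finrank_lt₅₆ ha x, GForm.of_zero, map_zero, Pi.zero_apply]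
    exact zero_mem _
  · rw [← sum_primitiveProj_apply (η := η) ha x, GForm.of_sum, map_sum, Finset.sum_apply]
    refine Submodule.sum_mem _ fun r hr ↦ ?_
    obtain ⟨har, h2r⟩ := mem_lefschetzRange.1 hr
    rw [hodgeInvolution_of_eq_smul_weylOperator_of_of_mem_lefschetzSummandForms hη rfl (k := a - 2 * r) (n := finrank ℂ E + 2 * r - a)
      (r := finrank ℂ E + r - a) (by omega) (by omega) (by omega) (primitiveProj_apply_mem hη ha r x), Pi.smul_apply, factor_eq_ratCast₅₆']
    exact ratCast_smul_mem₅₆ (hNS.weylOperator_of_apply_mem_rationalForms Φ hη (primitiveProj_apply_mem_rationalForms Φ hNS hη r hx) b) _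

/-- **`∗(H•(X; ℚ)) ⊆ H•(X; ℚ)`.** [cite: Milne1999LefschetzClasses, §5 p. 665 (proof of Thm. 5.9)] [cite: Kleiman1968AlgebraicCycles, §1.4, 1.4.4] -/
theorem IsNSForm.hodgeInvolution_apply_mem_rationalFormsG (hNS : IsNSForm Φ η) (hη : ∀ v : E, v ≠ 0 → ∃ w : E, η ![v, w] ≠ 0) {w : GForm E ℂ}
    (hw : w ∈ rationalFormsG Φ) : (hasLefschetzProperty_lefschetzG hη).hodgeInvolution isZGrading_countingG (finrank ℂ E) w ∈ rationalFormsG Φ := by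
  rw [← sum_range_of_eq w, map_sum]
  refine Submodule.sum_mem _ fun m _ ↦ (mem_rationalFormsG_iff Φ).2 fun b ↦ ?_
  exact hNS.hodgeInvolution_of_apply_mem_rationalForms Φ hη ((mem_rationalFormsG_iff Φ).1 hw m) b

/-- **KLEIMAN–MILNE'S `∗` IS DEFINED OVER `ℚ`: `∗ ∈ 𝔤𝔩(H•(X; ℚ))`** for every non-degenerate `η ∈ NS(X)` ("this algebra [`ℚ[L, Λ]`] contains `ᶜΛ` and `∗`").
[cite: Milne1999LefschetzClasses, §5 p. 665 (proof of Thm. 5.9)] [cite: Kleiman1968AlgebraicCycles, §1.4, 1.4.4] [cite: LooijengaLunts1997, §1 (1.7)] -/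
theorem IsNSForm.hodgeInvolution_mem_rationalEnd (hNS : IsNSForm Φ η) (hη : ∀ v : E, v ≠ 0 → ∃ w : E, η ![v, w] ≠ 0) :
    (hasLefschetzProperty_lefschetzG hη).hodgeInvolution isZGrading_countingG (finrank ℂ E) ∈ rationalEnd Φ :=
  fun _ hw ↦ hNS.hodgeInvolution_apply_mem_rationalFormsG Φ hη hw

end Rational

/-! ## §3 Hodge type and Hodge classes: `*_L, ∗ : Hdgᵖ(X) ⥲ Hdg^{g-p}(X)` -/

section HodgeClasses

variable {ι : Type*} [Fintype ι] [DecidableEq ι] {E : Type uE} [NormedAddCommGroup E] [NormedSpace ℂ E] [FiniteDimensional ℂ E] [Nontrivial E]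
  (Φ : (ι → ℝ) ≃L[ℝ] E) {η : E [⋀^Fin 2]→L[ℝ] ℝ}

omit [Fintype ι] [DecidableEq ι] [Nontrivial E] in
/-- Forms of degree above `2g` vanish (copy for this section). [folklore] -/
private theorem eq_zero_of_two_mul_finrank_lt₅₇ {a : ℕ} (ha : 2 * finrank ℂ E < a) (x : E [⋀^Fin a]→L[ℝ] ℂ) : x = 0 :=
  eq_zero_of_finrank_real_lt x (by rw [finrank_real_of_complex]; omega)

omit [Fintype ι] [DecidableEq ι] in
/-- **`*_L(H^{p,q} ∩ Hᵃ) ⊆ H^{g-q,g-p} ∩ Hᵇ`** (`p + q = a`, `a + b = 2g`, `p' = g - q`, `q' = g - p`) for every non-degenerate `η` of type `(1,1)`: the Lefschetz components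
`π_{a,r} x` of a `(p,q)`-class are `(p,q)`-classes (the projectors have bidegree `(0,0)`), and on each `*_L` is a multiple of `w`, which has this type rule (Huybrechts'
Lemma 1.2.24 (ii)). [cite: Huybrechts2005, §1.2 Lemma 1.2.24 (ii) (p0047 L2), Rem. 1.2.33, Prop. 3.3.13] [cite: VoisinHodgeI2002, §6.2.3 Rem. 6.27] -/
theorem lefschetzInvolution_of_apply_mem_typeSubmodule (h11 : ∀ u v : E, η ![Complex.I • u, Complex.I • v] = η ![u, v])
    (hη : ∀ v : E, v ≠ 0 → ∃ w : E, η ![v, w] ≠ 0) {a b p q p' q' : ℕ} (hab : a + b = 2 * finrank ℂ E) (hpq : p + q = a)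
    (hp' : p' + q = finrank ℂ E) (hq' : q' + p = finrank ℂ E) {x : E [⋀^Fin a]→L[ℝ] ℂ} (hx : x ∈ typeSubmodule E a p q) :
    (hasLefschetzProperty_lefschetzG hη).lefschetzInvolution isZGrading_countingG (GForm.of a x) b ∈ typeSubmodule E b p' q' := by
  have ha : a ≤ 2 * finrank ℂ E := by omega
  rw [← sum_primitiveProj_apply (η := η) ha x, GForm.of_sum, map_sum, Finset.sum_apply]
  refine Submodule.sum_mem _ fun r hr ↦ ?_
  obtain ⟨har, h2r⟩ := mem_lefschetzRange.1 hr
  rw [lefschetzInvolution_of_eq_smul_weylOperator_of_of_mem_lefschetzSummandForms hη rfl (k := a - 2 * r) (n := finrank ℂ E + 2 * r - a)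
    (r := finrank ℂ E + r - a) (by omega) (by omega) (by omega) (primitiveProj_apply_mem hη ha r x), Pi.smul_apply]
  exact Submodule.smul_mem _ _ (weylOperator_of_apply_mem_typeSubmodule hη h11 hab hpq hp' hq' (primitiveProj_apply_mem_typeSubmodule h11 hη hpq r hx))

omit [Fintype ι] [DecidableEq ι] in
/-- **`∗(H^{p,q} ∩ Hᵃ) ⊆ H^{g-q,g-p} ∩ Hᵇ`** (Kleiman–Milne's `∗`, `d = g`; hypotheses as above). [cite: Huybrechts2005, §1.2 Lemma 1.2.24 (ii) (p0047 L2), Rem. 1.2.33]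
[cite: Milne1999LefschetzClasses, §5 p. 664] -/
theorem hodgeInvolution_of_apply_mem_typeSubmodule (h11 : ∀ u v : E, η ![Complex.I • u, Complex.I • v] = η ![u, v])
    (hη : ∀ v : E, v ≠ 0 → ∃ w : E, η ![v, w] ≠ 0) {a b p q p' q' : ℕ} (hab : a + b = 2 * finrank ℂ E) (hpq : p + q = a)
    (hp' : p' + q = finrank ℂ E) (hq' : q' + p = finrank ℂ E) {x : E [⋀^Fin a]→L[ℝ] ℂ} (hx : x ∈ typeSubmodule E a p q) :
    (hasLefschetzProperty_lefschetzG hη).hodgeInvolution isZGrading_countingG (finrank ℂ E) (GForm.of a x) b ∈ typeSubmodule E b p' q' := by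
  have ha : a ≤ 2 * finrank ℂ E := by omega
  rw [← sum_primitiveProj_apply (η := η) ha x, GForm.of_sum, map_sum, Finset.sum_apply]
  refine Submodule.sum_mem _ fun r hr ↦ ?_
  obtain ⟨har, h2r⟩ := mem_lefschetzRange.1 hr
  rw [hodgeInvolution_of_eq_smul_weylOperator_of_of_mem_lefschetzSummandForms hη rfl (k := a - 2 * r) (n := finrank ℂ E + 2 * r - a)
    (r := finrank ℂ E + r - a) (by omega) (by omega) (by omega) (primitiveProj_apply_mem hη ha r x), Pi.smul_apply]
  exact Submodule.smul_mem _ _ (weylOperator_of_apply_mem_typeSubmodule hη h11 hab hpq hp' hq' (primitiveProj_apply_mem_typeSubmodule h11 hη hpq r hx))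

omit [Fintype ι] [DecidableEq ι] in
/-- `*_L` undone on components: `*_L(of b (*_L(of a x))_b)_a = x` (`a + b = 2g`; `*_L² = 1` and homogeneity). [cite: Andre1996Motifs, §1.1 (p. 10, "involutions")] -/
theorem lefschetzInvolution_of_lefschetzInvolution_of_apply (hη : ∀ v : E, v ≠ 0 → ∃ w : E, η ![v, w] ≠ 0) {a b : ℕ}
    (hab : a + b = 2 * finrank ℂ E) (x : E [⋀^Fin a]→L[ℝ] ℂ) :
    (hasLefschetzProperty_lefschetzG hη).lefschetzInvolution isZGrading_countingG
        (GForm.of b ((hasLefschetzProperty_lefschetzG hη).lefschetzInvolution isZGrading_countingG (GForm.of a x) b)) a = x := by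
  rw [← lefschetzInvolution_of_eq_of hη hab x, (hasLefschetzProperty_lefschetzG hη).lefschetzInvolution_lefschetzInvolution isZGrading_countingG,
    GForm.of_apply_self]

omit [Fintype ι] [DecidableEq ι] in
/-- `∗` undone on components: `∗(of b (∗(of a x))_b)_a = x` (`a + b = 2g`; `∗² = 1`). [cite: Milne1999LefschetzClasses, §5 p. 664] -/
theorem hodgeInvolution_of_hodgeInvolution_of_apply (hη : ∀ v : E, v ≠ 0 → ∃ w : E, η ![v, w] ≠ 0) (d : ℕ) {a b : ℕ}
    (hab : a + b = 2 * finrank ℂ E) (x : E [⋀^Fin a]→L[ℝ] ℂ) :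
    (hasLefschetzProperty_lefschetzG hη).hodgeInvolution isZGrading_countingG d
        (GForm.of b ((hasLefschetzProperty_lefschetzG hη).hodgeInvolution isZGrading_countingG d (GForm.of a x) b)) a = x := by
  rw [← hodgeInvolution_of_eq_of hη d hab x, (hasLefschetzProperty_lefschetzG hη).hodgeInvolution_hodgeInvolution isZGrading_countingG d,
    GForm.of_apply_self]

omit [Fintype ι] [DecidableEq ι] in
/-- `*_L : Hᵃ → Hᵇ` (componentwise) is injective, `a + b = 2g`. [cite: Andre1996Motifs, §1.1 (p. 10)] -/
theorem lefschetzInvolution_of_apply_injective (hη : ∀ v : E, v ≠ 0 → ∃ w : E, η ![v, w] ≠ 0) {a b : ℕ} (hab : a + b = 2 * finrank ℂ E) :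
    Function.Injective fun x : E [⋀^Fin a]→L[ℝ] ℂ ↦
      (hasLefschetzProperty_lefschetzG hη).lefschetzInvolution isZGrading_countingG (GForm.of a x) b := fun x x' h ↦ by
  rw [← lefschetzInvolution_of_lefschetzInvolution_of_apply hη hab x, ← lefschetzInvolution_of_lefschetzInvolution_of_apply hη hab x']
  exact congrArg (fun y : E [⋀^Fin b]→L[ℝ] ℂ ↦
    (hasLefschetzProperty_lefschetzG hη).lefschetzInvolution isZGrading_countingG (GForm.of b y) a) h

omit [Fintype ι] [DecidableEq ι] in
/-- `∗ : Hᵃ → Hᵇ` (componentwise) is injective, `a + b = 2g`. [cite: Milne1999LefschetzClasses, §5 p. 664] -/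
theorem hodgeInvolution_of_apply_injective (hη : ∀ v : E, v ≠ 0 → ∃ w : E, η ![v, w] ≠ 0) (d : ℕ) {a b : ℕ} (hab : a + b = 2 * finrank ℂ E) :
    Function.Injective fun x : E [⋀^Fin a]→L[ℝ] ℂ ↦
      (hasLefschetzProperty_lefschetzG hη).hodgeInvolution isZGrading_countingG d (GForm.of a x) b := fun x x' h ↦ by
  rw [← hodgeInvolution_of_hodgeInvolution_of_apply hη d hab x, ← hodgeInvolution_of_hodgeInvolution_of_apply hη d hab x']
  exact congrArg (fun y : E [⋀^Fin b]→L[ℝ] ℂ ↦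
    (hasLefschetzProperty_lefschetzG hη).hodgeInvolution isZGrading_countingG d (GForm.of b y) a) h

/-- **`*_L(Hᵃ(X, ℚ) ∩ H^{p,p}) ⊆ Hᵇ(X, ℚ) ∩ H^{p',p'}`** (`p + p = a`, `a + b = 2g`, `p' + p = g`) for every non-degenerate `η ∈ NS(X)`: rationality (§2) and type (§3).
[cite: Milne1999LefschetzClasses, §5 p. 664–665 and Thm. 5.9] [cite: Huybrechts2005, §1.2 Lemma 1.2.24 (ii) (p0047 L2)] [cite: Lange2023AbelianVarietiesComplex, §7.2.2, §7.3.3 Exercise (1)] -/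
theorem IsNSForm.lefschetzInvolution_of_apply_mem_hodgeClassesIn (hNS : IsNSForm Φ η) (hη : ∀ v : E, v ≠ 0 → ∃ w : E, η ![v, w] ≠ 0) {a b p p' : ℕ}
    (hab : a + b = 2 * finrank ℂ E) (hpa : p + p = a) (hp' : p' + p = finrank ℂ E) {x : E [⋀^Fin a]→L[ℝ] ℂ} (hx : x ∈ hodgeClassesIn Φ a p) :
    (hasLefschetzProperty_lefschetzG hη).lefschetzInvolution isZGrading_countingG (GForm.of a x) b ∈ hodgeClassesIn Φ b p' :=
  ⟨hNS.lefschetzInvolution_of_apply_mem_rationalForms Φ hη hx.1 b,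
    lefschetzInvolution_of_apply_mem_typeSubmodule hNS.type_one_one hη hab hpa hp' hp' hx.2⟩

/-- **`*_L(Hᵃ(X, ℚ) ∩ H^{p,p}) = Hᵇ(X, ℚ) ∩ H^{g-p,g-p}`** (equality of sets; the preimage of `y` is `*_L(y)_a`). [cite: Milne1999LefschetzClasses, §5 p. 664–665 and Thm. 5.9]
[cite: Andre1996Motifs, §1.1 (p. 10)] -/
theorem IsNSForm.image_lefschetzInvolution_of_hodgeClassesIn (hNS : IsNSForm Φ η) (hη : ∀ v : E, v ≠ 0 → ∃ w : E, η ![v, w] ≠ 0) {a b p p' : ℕ}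
    (hab : a + b = 2 * finrank ℂ E) (hpa : p + p = a) (hp' : p' + p = finrank ℂ E) :
    (fun x : E [⋀^Fin a]→L[ℝ] ℂ ↦ (hasLefschetzProperty_lefschetzG hη).lefschetzInvolution isZGrading_countingG (GForm.of a x) b) ''
        (hodgeClassesIn Φ a p : Set (E [⋀^Fin a]→L[ℝ] ℂ)) = hodgeClassesIn Φ b p' := by
  have hba : b + a = 2 * finrank ℂ E := by omega
  refine Set.Subset.antisymm ?_ fun y hy ↦ ?_
  · rintro _ ⟨x, hx, rfl⟩
    exact hNS.lefschetzInvolution_of_apply_mem_hodgeClassesIn Φ hη hab hpa hp' hx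
  · exact ⟨_, hNS.lefschetzInvolution_of_apply_mem_hodgeClassesIn Φ hη hba (by omega) (by omega) hy,
      lefschetzInvolution_of_lefschetzInvolution_of_apply hη hba y⟩

/-- **`*_L : Hᵃ(X, ℚ) ∩ H^{p,p} ⥲ Hᵇ(X, ℚ) ∩ H^{g-p,g-p}` is a bijection.** [cite: Milne1999LefschetzClasses, §5 p. 664–665 and Thm. 5.9] [cite: Andre1996Motifs, §1.1 (p. 10)] -/
theorem IsNSForm.bijOn_lefschetzInvolution_of_hodgeClassesIn (hNS : IsNSForm Φ η) (hη : ∀ v : E, v ≠ 0 → ∃ w : E, η ![v, w] ≠ 0) {a b p p' : ℕ}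
    (hab : a + b = 2 * finrank ℂ E) (hpa : p + p = a) (hp' : p' + p = finrank ℂ E) :
    Set.BijOn (fun x : E [⋀^Fin a]→L[ℝ] ℂ ↦ (hasLefschetzProperty_lefschetzG hη).lefschetzInvolution isZGrading_countingG (GForm.of a x) b)
      (hodgeClassesIn Φ a p : Set (E [⋀^Fin a]→L[ℝ] ℂ)) (hodgeClassesIn Φ b p' : Set (E [⋀^Fin b]→L[ℝ] ℂ)) :=
  ⟨fun _ hx ↦ hNS.lefschetzInvolution_of_apply_mem_hodgeClassesIn Φ hη hab hpa hp' hx, (lefschetzInvolution_of_apply_injective hη hab).injOn,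
    (hNS.image_lefschetzInvolution_of_hodgeClassesIn Φ hη hab hpa hp').symm.subset⟩

/-- **`*_L : Hdgᵖ(X) ⥲ Hdg^q(X)` IS A BIJECTION for `p + q = g`**, every complex torus with a non-degenerate `η ∈ NS(X)` (every abelian variety): André's Lefschetz
involution identifies the `ℚ`-spaces of Hodge classes of complementary codimensions. [cite: Andre1996Motifs, §1.1 (p. 10), Prop. 1.2] [cite: Milne1999LefschetzClasses, §5 Thm. 5.9]
[cite: Lange2023AbelianVarietiesComplex, §7.3.3 Exercise (1)] -/
theorem IsNSForm.bijOn_lefschetzInvolution_of_hodgeClasses (hNS : IsNSForm Φ η) (hη : ∀ v : E, v ≠ 0 → ∃ w : E, η ![v, w] ≠ 0) {p q : ℕ}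
    (hpq : p + q = finrank ℂ E) :
    Set.BijOn (fun x : E [⋀^Fin (2 * p)]→L[ℝ] ℂ ↦ (hasLefschetzProperty_lefschetzG hη).lefschetzInvolution isZGrading_countingG (GForm.of (2 * p) x) (2 * q))
      (hodgeClasses Φ p : Set (E [⋀^Fin (2 * p)]→L[ℝ] ℂ)) (hodgeClasses Φ q : Set (E [⋀^Fin (2 * q)]→L[ℝ] ℂ)) :=
  hNS.bijOn_lefschetzInvolution_of_hodgeClassesIn Φ hη (by omega) (by omega) (by omega)

/-- **`∗(Hᵃ(X, ℚ) ∩ H^{p,p}) ⊆ Hᵇ(X, ℚ) ∩ H^{p',p'}`** (`p + p = a`, `a + b = 2g`, `p' + p = g`), `η ∈ NS(X)` non-degenerate. [cite: Milne1999LefschetzClasses, §5 p. 664–665 and Thm. 5.9]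
[cite: Huybrechts2005, §1.2 Lemma 1.2.24 (ii) (p0047 L2)] -/
theorem IsNSForm.hodgeInvolution_of_apply_mem_hodgeClassesIn (hNS : IsNSForm Φ η) (hη : ∀ v : E, v ≠ 0 → ∃ w : E, η ![v, w] ≠ 0) {a b p p' : ℕ}
    (hab : a + b = 2 * finrank ℂ E) (hpa : p + p = a) (hp' : p' + p = finrank ℂ E) {x : E [⋀^Fin a]→L[ℝ] ℂ} (hx : x ∈ hodgeClassesIn Φ a p) :
    (hasLefschetzProperty_lefschetzG hη).hodgeInvolution isZGrading_countingG (finrank ℂ E) (GForm.of a x) b ∈ hodgeClassesIn Φ b p' :=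
  ⟨hNS.hodgeInvolution_of_apply_mem_rationalForms Φ hη hx.1 b,
    hodgeInvolution_of_apply_mem_typeSubmodule hNS.type_one_one hη hab hpa hp' hp' hx.2⟩

/-- **`∗(Hᵃ(X, ℚ) ∩ H^{p,p}) = Hᵇ(X, ℚ) ∩ H^{g-p,g-p}`** (equality of sets). [cite: Milne1999LefschetzClasses, §5 p. 664–665 and Thm. 5.9] -/
theorem IsNSForm.image_hodgeInvolution_of_hodgeClassesIn (hNS : IsNSForm Φ η) (hη : ∀ v : E, v ≠ 0 → ∃ w : E, η ![v, w] ≠ 0) {a b p p' : ℕ}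
    (hab : a + b = 2 * finrank ℂ E) (hpa : p + p = a) (hp' : p' + p = finrank ℂ E) :
    (fun x : E [⋀^Fin a]→L[ℝ] ℂ ↦ (hasLefschetzProperty_lefschetzG hη).hodgeInvolution isZGrading_countingG (finrank ℂ E) (GForm.of a x) b) ''
        (hodgeClassesIn Φ a p : Set (E [⋀^Fin a]→L[ℝ] ℂ)) = hodgeClassesIn Φ b p' := by
  have hba : b + a = 2 * finrank ℂ E := by omega
  refine Set.Subset.antisymm ?_ fun y hy ↦ ?_
  · rintro _ ⟨x, hx, rfl⟩
    exact hNS.hodgeInvolution_of_apply_mem_hodgeClassesIn Φ hη hab hpa hp' hx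
  · exact ⟨_, hNS.hodgeInvolution_of_apply_mem_hodgeClassesIn Φ hη hba (by omega) (by omega) hy,
      hodgeInvolution_of_hodgeInvolution_of_apply hη _ hba y⟩

/-- **`∗ : Hᵃ(X, ℚ) ∩ H^{p,p} ⥲ Hᵇ(X, ℚ) ∩ H^{g-p,g-p}` is a bijection.** [cite: Milne1999LefschetzClasses, §5 p. 664–665 and Thm. 5.9] -/
theorem IsNSForm.bijOn_hodgeInvolution_of_hodgeClassesIn (hNS : IsNSForm Φ η) (hη : ∀ v : E, v ≠ 0 → ∃ w : E, η ![v, w] ≠ 0) {a b p p' : ℕ}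
    (hab : a + b = 2 * finrank ℂ E) (hpa : p + p = a) (hp' : p' + p = finrank ℂ E) :
    Set.BijOn (fun x : E [⋀^Fin a]→L[ℝ] ℂ ↦ (hasLefschetzProperty_lefschetzG hη).hodgeInvolution isZGrading_countingG (finrank ℂ E) (GForm.of a x) b)
      (hodgeClassesIn Φ a p : Set (E [⋀^Fin a]→L[ℝ] ℂ)) (hodgeClassesIn Φ b p' : Set (E [⋀^Fin b]→L[ℝ] ℂ)) :=
  ⟨fun _ hx ↦ hNS.hodgeInvolution_of_apply_mem_hodgeClassesIn Φ hη hab hpa hp' hx, (hodgeInvolution_of_apply_injective hη _ hab).injOn,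
    (hNS.image_hodgeInvolution_of_hodgeClassesIn Φ hη hab hpa hp').symm.subset⟩

/-- **KLEIMAN–MILNE'S `∗ : Hdgᵖ(X) ⥲ Hdg^q(X)` IS A BIJECTION for `p + q = g`** (every complex torus with a non-degenerate `η ∈ NS(X)`): the combinatorial star — on an abelian
variety a Lefschetz, hence algebraic, correspondence (Milne's Thm. 5.9) — permutes the Hodge classes of complementary codimensions.
[cite: Milne1999LefschetzClasses, §5 Thm. 5.9, Rem. 5.11] [cite: Kleiman1968AlgebraicCycles, §1.4, 1.4.4] [cite: Lange2023AbelianVarietiesComplex, §7.3.3 Exercise (1)] -/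
theorem IsNSForm.bijOn_hodgeInvolution_of_hodgeClasses (hNS : IsNSForm Φ η) (hη : ∀ v : E, v ≠ 0 → ∃ w : E, η ![v, w] ≠ 0) {p q : ℕ}
    (hpq : p + q = finrank ℂ E) :
    Set.BijOn (fun x : E [⋀^Fin (2 * p)]→L[ℝ] ℂ ↦
        (hasLefschetzProperty_lefschetzG hη).hodgeInvolution isZGrading_countingG (finrank ℂ E) (GForm.of (2 * p) x) (2 * q))
      (hodgeClasses Φ p : Set (E [⋀^Fin (2 * p)]→L[ℝ] ℂ)) (hodgeClasses Φ q : Set (E [⋀^Fin (2 * q)]→L[ℝ] ℂ)) :=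
  hNS.bijOn_hodgeInvolution_of_hodgeClassesIn Φ hη (by omega) (by omega) (by omega)

/-- **On a polarized complex torus (`η` a Riemann form): `∗ : Hdgᵖ(X) ⥲ Hdg^{g-p}(X)`.** [cite: Milne1999LefschetzClasses, §5 Thm. 5.9] [cite: Lange2023AbelianVarietiesComplex, §7.3.3 Exercise (1)] -/
theorem IsRiemannForm.bijOn_hodgeInvolution_of_hodgeClasses (hR : IsRiemannForm Φ η) {p q : ℕ} (hpq : p + q = finrank ℂ E) :
    Set.BijOn (fun x : E [⋀^Fin (2 * p)]→L[ℝ] ℂ ↦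
        (hasLefschetzProperty_lefschetzG (hR.exists_apply_ne_zero Φ)).hodgeInvolution isZGrading_countingG (finrank ℂ E) (GForm.of (2 * p) x) (2 * q))
      (hodgeClasses Φ p : Set (E [⋀^Fin (2 * p)]→L[ℝ] ℂ)) (hodgeClasses Φ q : Set (E [⋀^Fin (2 * q)]→L[ℝ] ℂ)) :=
  (hR.isNSForm Φ).bijOn_hodgeInvolution_of_hodgeClasses Φ (hR.exists_apply_ne_zero Φ) hpq

end HodgeClasses

end ComplexTorus

end Literature.Geometry.Kaehler

end
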